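import Literature.AlgebraicGeometry.HodgeTheory.WeilTypeOffByOneTimesCMCurvePowersHodgeConjecture
import Literature.AlgebraicGeometry.HodgeTheory.NoTypeIVTimesCMGrouping
import Literature.AlgebraicGeometry.HodgeTheory.HodgeGroupProductCMFactorClasses
import Literature.AlgebraicGeometry.HodgeTheory.HodgeConjectureIsogenyInvariance
import HarnessLib

/-!
# TABLE X (dimension 6) — row 21 `g6.E3xY3.(2,1)` over `ℚ(i)` and `ℚ(√-3)`: the Hodge conjecture for every
# `A ∼ E_k³ × Y₃` (and for `A ∼ Y₃ × Y₃`), MODULO the displayed refereed binder Abdulali 2012 Thm. 14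
# (cell `pub-hodgeav-hg6`, req-37 (A) Q2b; eng-2 g6, memo `HOME/jobs/ROW21-FF26-eng2g6/MEMO.md` §3a; RECORD lane)

HONEST FRAMING. HC, `HC_AV` (stmt-1333), `HC_CM` (stmt-3052) and the rung H2 are NOT proved and do not occur here.
Everything in §2–§3 is CONDITIONAL on the displayed named fact
`(h12 : Abdulali2012_hodgeClasses_algebraic_powSucc_prod_cmCurve)` of
`HodgeTheory/WeilTypeOffByOneTimesCMCurvePowersHodgeConjecture` — S. Abdulali, *Tate twists of Hodge structures arising
from abelian varieties of type IV*, J. Pure Appl. Algebra 216 (2012) 1164–1170, **Thm. 14** [corpus: paper:arxiv-1203.4857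
p0010 L5–L21] (REFEREED; survey LMS LN 427 App. A item 4): the (usual) Hodge conjecture for all powers of `Y × E`, `Y` a
SIMPLE `(2,1)`-threefold (or `(3,2)`-fivefold) with `End⁰(Y) = K`, `E` an elliptic curve with CM by `K`, for
`K = ℚ(i)` or `ℚ(√-3)` ONLY. The binder is displayed, never discharged; KIND of `HC_CM`: ABSENT. No definition, no
`sorry`, no new named fact; typed ≠ proved.

WHY THIS MODULE. TABLE X row 21 (`HOME/TABLE-X-g6-v0.md` §1: `X = E_k³ × Y₃/k (2,1)`, `Hg ⊊ L`, exceptional classes in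
`B²` = pull-backs of the Weil classes `W_k(E_k × Y₃)` of the three fourfold quotients, «KNOWN (Floccari–Fu, all powers of
`E × Y₃`; `X` is a factor-image)») is on the cell's theorem-less floor with only a named-fact route (lead g2 01:41:07Z). The
all-`d` route (Floccari–Fu 2026 Thm. 1.2, `FloccariFu2026_hodgeClasses_algebraic_powers_discOneWeilFourfold`) needs a
discriminant-1 K-symmetrised HYPERPLANE class on `Y₃ × E` — arithmetic + Segre inputs the tree does not yet hold (memo §3b).
For `K = ℚ(i)`, `ℚ(√-3)` the tree's Abdulali binder applies to `(Y₃ × E)^(N+1)` DIRECTLY, and row 21 is a FACTOR of the cube: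
`(E³ × Y₃) × Y₃² ∼ (Y₃ × E)³`. This file is that bookkeeping:
* §1 product isogeny algebra (unconditional): `isIsogenous_prod_prod_prod_comm` (middle-four interchange),
  `isIsogenous_powSucc_congr`, **`isIsogenous_powSucc_prod`** (`(A × B)^(n+1) ∼ A^(n+1) × B^(n+1)`),
  `isIsogenous_cmCurveCube_prod_threefold_prod_sq` (`(E³ × Y) × (Y × Y) ∼ (Y × E)³`).
* §2 `hodgeConjectureFor_of_prod_isIsogenous_powSucc_of_abdulali2012` — every abelian variety `A` with `A × C ∼ (Y × E)^(N+1)`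
  for some `C`, `N` (an isogeny FACTOR of a power) satisfies `HodgeConjectureFor`, modulo `h12`
  (`hodgeConjectureFor_left_of_prod` + `HodgeConjectureFor.of_isIsogenous`).
* §3 **`hodgeConjectureFor_row21_of_abdulali2012`** — TABLE X row 21 over `ℚ(i)`, `ℚ(√-3)`: every `A ∼ E³ × Y₃` (here
  `E.powSucc 2 × Y`), modulo `h12`; `hodgeConjectureFor_sq_unitaryTwoOne_of_abdulali2012` — the special member `A ∼ Y₃ × Y₃`
  of row 19 (same factor twice), modulo `h12`. (No `HCOnClass` spelling: this file imports no route-dependent module.)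

READING (honest scope). Signature `(2,1)` is carried, as in the binder, by `IsWeilType (Y × E) (φ × ψ) 2 d` (the product is
of Weil type `(2,2)`: `k` acts on `H^{1,0}(Y)` with multiplicities `{2,1}` and through the complementary embedding on `E`);
`End⁰(Y) = K` as «every endomorphism `χ` has `m χ = p 𝟙 + q φ`». Fields other than `ℚ(i)`, `ℚ(√-3)`: NOT covered (FF26 route,
memo §3b). The CENSUS nodes X2 / X1 at row 21 are NOT touched (they are span statements; memo §3c names the two bricks that
would put them in the kernel over the in-tree resonant Lie step `HodgeThetaAnnihilatorUnitaryTimesCMCurve`). No inhabitant is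
exhibited and none is invented. Nothing here is a corollary of `HC_CM`; typed ≠ proved.
-/

set_option linter.dupNamespace false

noncomputable section

open CategoryTheory
open Literature.AlgebraicGeometry Literature.AlgebraicGeometry.Motives
open Literature.AlgebraicGeometry.Motives.AbelianVariety (IsIsogenous IsSimple powSucc powSucc_zero powSucc_succ)
open Literature.AlgebraicGeometry.HodgeTheory

namespace Summit.HodgeConjecture.HodgeConjecture.TableX.ProductRows

/-! ## §1 Product isogeny algebra (unconditional) -/

/-- **Middle-four interchange up to isogeny: `(P × Q) × (A × B) ∼ (P × A) × (Q × B)`** (commutativity and associativity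
of `×` up to isogeny, `isIsogenous_prod_comm` / `isIsogenous_prod_assoc`, and `IsIsogenous.prod`).
[cite: Milne1986AbelianVarieties, §12 Prop. 12.1 and p. 122] -/
theorem isIsogenous_prod_prod_prod_comm (P Q A B : AbelianVariety ℂ) :
    IsIsogenous ((P.prod Q).prod (A.prod B)) ((P.prod A).prod (Q.prod B)) := by
  -- `(P × Q) × (A × B) ∼ P × (Q × (A × B))`
  refine (isIsogenous_prod_assoc P Q (A.prod B)).trans ?_
  -- `Q × (A × B) ∼ (Q × A) × B ∼ (A × Q) × B ∼ A × (Q × B)`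
  have h1 : IsIsogenous (Q.prod (A.prod B)) (A.prod (Q.prod B)) :=
    ((isIsogenous_prod_assoc Q A B).symm'.trans
      ((isIsogenous_prod_comm Q A).prod (IsIsogenous.refl B))).trans (isIsogenous_prod_assoc A Q B)
  -- `P × (A × (Q × B)) ∼ (P × A) × (Q × B)`
  exact ((IsIsogenous.refl P).prod h1).trans (isIsogenous_prod_assoc P A (Q.prod B)).symm'

/-- **Powers respect isogeny: `A ∼ B ⟹ A^(n+1) ∼ B^(n+1)`.** [cite: Milne1986AbelianVarieties, §12 Prop. 12.1 and p. 122] -/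
theorem isIsogenous_powSucc_congr {A B : AbelianVariety ℂ} (h : IsIsogenous A B) :
    ∀ n : ℕ, IsIsogenous (A.powSucc n) (B.powSucc n)
  | 0 => h
  | n + 1 => by
    rw [powSucc_succ, powSucc_succ]
    exact (isIsogenous_powSucc_congr h n).prod h

/-- **`(A × B)^(n+1) ∼ A^(n+1) × B^(n+1)`** (induction with the middle-four interchange).
[cite: Milne1986AbelianVarieties, §12 Prop. 12.1 and p. 122] -/
theorem isIsogenous_powSucc_prod (A B : AbelianVariety ℂ) :
    ∀ n : ℕ, IsIsogenous ((A.prod B).powSucc n) ((A.powSucc n).prod (B.powSucc n))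
  | 0 => IsIsogenous.refl _
  | n + 1 => by
    rw [powSucc_succ, powSucc_succ, powSucc_succ]
    exact ((isIsogenous_powSucc_prod A B n).prod (IsIsogenous.refl _)).trans
      (isIsogenous_prod_prod_prod_comm (A.powSucc n) (B.powSucc n) A B)

/-- **`(E³ × Y) × (Y × Y) ∼ (Y × E)³`** (`E³ = E.powSucc 2 = (E × E) × E`, `(Y × E)³ = (Y × E).powSucc 2`): the row-21 sixfold
`E³ × Y` is an isogeny FACTOR of the cube of the Weil fourfold `Y × E`, with complement `Y²`.
[cite: Milne1986AbelianVarieties, §12 Prop. 12.1 and p. 122] -/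
theorem isIsogenous_cmCurveCube_prod_threefold_prod_sq (E Y : AbelianVariety ℂ) :
    IsIsogenous (((E.powSucc 2).prod Y).prod (Y.prod Y)) ((Y.prod E).powSucc 2) := by
  -- `(E³ × Y) × (Y × Y) ∼ E³ × (Y × (Y × Y)) ∼ E³ × Y³ ∼ Y³ × E³ ∼ (Y × E)³`
  have hY3 : IsIsogenous (Y.prod (Y.prod Y)) (Y.powSucc 2) := by
    rw [powSucc_succ, powSucc_succ, powSucc_zero]
    exact (isIsogenous_prod_assoc Y Y Y).symm'
  exact (((isIsogenous_prod_assoc (E.powSucc 2) Y (Y.prod Y)).trans ((IsIsogenous.refl _).prod hY3)).trans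
    (isIsogenous_prod_comm _ _)).trans (isIsogenous_powSucc_prod Y E 2).symm'

/-! ## §2 Isogeny factors of powers of `Y × E`, modulo Abdulali's Thm. 14 -/

section Abdulali

variable {Y E : AbelianVariety ℂ} {φ : Y ⟶ Y} {ψ : E ⟶ E} {d : ℕ}

/-- **Every isogeny FACTOR of a power of `Y × E` satisfies the Hodge conjecture, modulo Abdulali 2012 Thm. 14**: for `Y` a
simple `(2,1)`-threefold with `End⁰(Y) = K`, `E` a CM curve by `K`, `K = ℚ(i)` or `ℚ(√-3)` (binders exactly those of the named
fact, with `k = 1`), and `A × C ∼ (Y × E)^(N+1)`: `HodgeConjectureFor A` (the fact at `N`, isogeny invariance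
`HodgeConjectureFor.of_isIsogenous` = van Geemen Lemma 3.7, and the factor lemma `hodgeConjectureFor_left_of_prod`).
CONDITIONAL on the displayed binder `h12`. [cite: Abdulali2012TateTwistsIV, Thm. 14 (p. 1169)] [cite: vanGeemen1994HodgeAV, Lemma 3.7]
[cite: Fulton1998, §19.2 Cor. 19.2 (b)] -/
theorem hodgeConjectureFor_of_prod_isIsogenous_powSucc_of_abdulali2012
    (h12 : Abdulali2012_hodgeClasses_algebraic_powSucc_prod_cmCurve) (hd : d = 1 ∨ d = 3) (hY : Y.dim = 3)
    (hE : E.dim = 1) (hYs : Y.IsSimple) (hφ : φ ≫ φ = -(d • 𝟙 Y)) (hψ : ψ ≫ ψ = -(d • 𝟙 E))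
    (hEnd : ∀ χ : Y ⟶ Y, ∃ (m : ℕ) (p q : ℤ), 0 < m ∧ (m : ℤ) • χ = p • 𝟙 Y + q • φ)
    (hW : IsWeilType (Y.prod E)
      (Motives.AbelianVariety.prodLift (Motives.AbelianVariety.fst Y E ≫ φ) (Motives.AbelianVariety.snd Y E ≫ ψ)) 2 d)
    {A C : AbelianVariety ℂ} {N : ℕ} (hAC : IsIsogenous (A.prod C) ((Y.prod E).powSucc N)) :
    HodgeConjectureFor A.dim A.X :=
  hodgeConjectureFor_left_of_prod A C
    (HodgeConjectureFor.of_isIsogenous hAC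
      (h12 Y E φ ψ 1 d (Or.inl rfl) hd (by rw [hY]) hE hYs hφ hψ hEnd hW N))

/-- **Everything isogenous to a power of `Y × E` satisfies the Hodge conjecture, modulo Abdulali 2012 Thm. 14** (the case
`C`-free: `A ∼ (Y × E)^(N+1)`). CONDITIONAL on `h12`. [cite: Abdulali2012TateTwistsIV, Thm. 14 (p. 1169)]
[cite: vanGeemen1994HodgeAV, Lemma 3.7] -/
theorem hodgeConjectureFor_of_isIsogenous_powSucc_of_abdulali2012
    (h12 : Abdulali2012_hodgeClasses_algebraic_powSucc_prod_cmCurve) (hd : d = 1 ∨ d = 3) (hY : Y.dim = 3)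
    (hE : E.dim = 1) (hYs : Y.IsSimple) (hφ : φ ≫ φ = -(d • 𝟙 Y)) (hψ : ψ ≫ ψ = -(d • 𝟙 E))
    (hEnd : ∀ χ : Y ⟶ Y, ∃ (m : ℕ) (p q : ℤ), 0 < m ∧ (m : ℤ) • χ = p • 𝟙 Y + q • φ)
    (hW : IsWeilType (Y.prod E)
      (Motives.AbelianVariety.prodLift (Motives.AbelianVariety.fst Y E ≫ φ) (Motives.AbelianVariety.snd Y E ≫ ψ)) 2 d)
    {A : AbelianVariety ℂ} {N : ℕ} (hA : IsIsogenous A ((Y.prod E).powSucc N)) : HodgeConjectureFor A.dim A.X :=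
  HodgeConjectureFor.of_isIsogenous hA (h12 Y E φ ψ 1 d (Or.inl rfl) hd (by rw [hY]) hE hYs hφ hψ hEnd hW N)

/-! ## §3 TABLE X row 21 (and the square `Y₃ × Y₃`), modulo Abdulali's Thm. 14 -/

/-- **TABLE X ROW 21 `g6.E3xY3.(2,1)` over `ℚ(i)` and `ℚ(√-3)`, MODULO Abdulali 2012 Thm. 14: the Hodge conjecture for every
complex abelian variety isogenous to `E³ × Y`** (`E.powSucc 2 × Y`), for `Y` a simple `(2,1)`-threefold with `End⁰(Y) = K`,
`E` an elliptic curve with CM by `K = ℚ(√-d)`, `d ∈ {1, 3}` (binders of the named fact, `k = 1`): `(E³ × Y) × Y² ∼ (Y × E)³`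
(§1) and §2 at `N = 2`. CONDITIONAL on the displayed refereed binder `h12`; the FF26 all-`d` route is NOT formalised here;
the census nodes X2 / X1 at row 21 are untouched. [cite: Abdulali2012TateTwistsIV, Thm. 14 (p. 1169)]
[cite: Abdulali2016TateTwists, App. A item 4] [cite: vanGeemen1994HodgeAV, Lemma 3.7] -/
theorem hodgeConjectureFor_row21_of_abdulali2012
    (h12 : Abdulali2012_hodgeClasses_algebraic_powSucc_prod_cmCurve) (hd : d = 1 ∨ d = 3) (hY : Y.dim = 3)
    (hE : E.dim = 1) (hYs : Y.IsSimple) (hφ : φ ≫ φ = -(d • 𝟙 Y)) (hψ : ψ ≫ ψ = -(d • 𝟙 E))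
    (hEnd : ∀ χ : Y ⟶ Y, ∃ (m : ℕ) (p q : ℤ), 0 < m ∧ (m : ℤ) • χ = p • 𝟙 Y + q • φ)
    (hW : IsWeilType (Y.prod E)
      (Motives.AbelianVariety.prodLift (Motives.AbelianVariety.fst Y E ≫ φ) (Motives.AbelianVariety.snd Y E ≫ ψ)) 2 d)
    {A : AbelianVariety ℂ} (hA : IsIsogenous A ((E.powSucc 2).prod Y)) : HodgeConjectureFor A.dim A.X :=
  hodgeConjectureFor_of_prod_isIsogenous_powSucc_of_abdulali2012 h12 hd hY hE hYs hφ hψ hEnd hW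
    ((hA.prod (IsIsogenous.refl (Y.prod Y))).trans (isIsogenous_cmCurveCube_prod_threefold_prod_sq E Y))

/-- **The square `Y × Y` of a simple `(2,1)`-threefold over `ℚ(i)` / `ℚ(√-3)` (a special member of TABLE X row 19, the same
factor twice), MODULO Abdulali 2012 Thm. 14:** every `A ∼ Y × Y` satisfies the Hodge conjecture — `(Y × Y) × (E × E) ∼ (Y × E)²`
and §2 at `N = 1`. CONDITIONAL on `h12`. [cite: Abdulali2012TateTwistsIV, Thm. 14 (p. 1169)] [cite: vanGeemen1994HodgeAV, Lemma 3.7] -/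
theorem hodgeConjectureFor_sq_unitaryTwoOne_of_abdulali2012
    (h12 : Abdulali2012_hodgeClasses_algebraic_powSucc_prod_cmCurve) (hd : d = 1 ∨ d = 3) (hY : Y.dim = 3)
    (hE : E.dim = 1) (hYs : Y.IsSimple) (hφ : φ ≫ φ = -(d • 𝟙 Y)) (hψ : ψ ≫ ψ = -(d • 𝟙 E))
    (hEnd : ∀ χ : Y ⟶ Y, ∃ (m : ℕ) (p q : ℤ), 0 < m ∧ (m : ℤ) • χ = p • 𝟙 Y + q • φ)
    (hW : IsWeilType (Y.prod E)
      (Motives.AbelianVariety.prodLift (Motives.AbelianVariety.fst Y E ≫ φ) (Motives.AbelianVariety.snd Y E ≫ ψ)) 2 d)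
    {A : AbelianVariety ℂ} (hA : IsIsogenous A (Y.prod Y)) : HodgeConjectureFor A.dim A.X := by
  refine hodgeConjectureFor_of_prod_isIsogenous_powSucc_of_abdulali2012 h12 hd hY hE hYs hφ hψ hEnd hW
    (C := E.prod E) (N := 1) ?_
  -- `(A × (E × E)) ∼ (Y × Y) × (E × E) ∼ (Y × E) × (Y × E) = (Y × E).powSucc 1`
  rw [powSucc_succ, powSucc_zero]
  exact (hA.prod (IsIsogenous.refl (E.prod E))).trans (isIsogenous_prod_prod_prod_comm Y Y E E)

end Abdulali

end Summit.HodgeConjecture.HodgeConjecture.TableX.ProductRows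

end
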